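import Mathlib
import HarnessLib

/-!
# Principal pivot transform over a field: the exchange relation and the singularity of principal minors

Cell `b2b-bsdres`, O1 (p = 2) PROVER ORDER v2.8 (ii′) (o1 PLAN §16), support file for stub₂″
`PivotRebase` of lens-2's "Selmer solitaire" (`HOME/b2b-bsdres-o1-idea-2-g5/lean/O1Stub2Sketch.lean`,
ROUTES-O1 §lens-2 G5.10).  Pure linear algebra, no arithmetic; reach-neutral (R1's combinatorial leaf
only; nothing booked, no mark).  HONEST FRAMING (cell, verbatim): published theorems only; nothing here
books anything; O1 OPEN.

For a square matrix `M` over a field indexed by a finite type `ι` and a finite set `A ⊆ ι` at which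
the principal submatrix `M[A]` is invertible, the **principal pivot transform** (Tucker 1960)
`pivot M A` is the matrix `[[M[A]⁻¹, -M[A]⁻¹ M[A,B]], [M[B,A] M[A]⁻¹, M[B] - M[B,A] M[A]⁻¹ M[A,B]]]`
(`B = ι ∖ A`), written entrywise.  Its defining property is the **exchange relation**
(`pivot_mulVec_piecewise`, `mulVec_piecewise_pivot`): `M x = y ⟺ (pivot M A) (y|_A, x|_B) = (x|_A, y|_B)`.
Consequence (`sing_pivot_iff`, Tucker's theorem in its determinant-free form): for every `Y ⊆ ι` the
principal submatrix `(pivot M A)[Y]` is singular iff `M[Y ∆ A]` is singular — kernel vectors are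
exchanged by `x ↦ (Mx|_A, x|_B)`.  Singularity of a principal submatrix is expressed on `ι` itself
(`det_submatrix_eq_zero_iff`: `det M[Y] = 0` iff some `x ≠ 0` supported on `Y` has `(Mx)|_Y = 0`).

References: A. W. Tucker, *A combinatorial equivalence of matrices* (1960); M. J. Tsatsomeros,
*Principal pivot transforms: properties and applications*, Linear Algebra Appl. 307 (2000) 151–165,
Thm. 3.1 / (the "exchange" Lemma 3.3); A. Bouchet, *Representability of Δ-matroids* (1988) §3.
[cite: Tsatsomeros2000, Thm. 3.1] Mathlib: `Matrix.exists_mulVec_eq_zero_iff`, `Matrix.nonsing_inv_mul`,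
`Finset.piecewise`, `Finset.sum_add_sum_compl`; no principal pivot transform in Mathlib
(`lean search 'principal pivot|ppt'`: nothing).
-/

namespace Summit.BirchSwinnertonDyer.Rank1Residual.X5.SelmerSolitaire

open Finset Matrix

variable {ι : Type*} [Fintype ι] [DecidableEq ι] {𝔽 : Type*} [Field 𝔽]

/-! ## Principal minors: singularity read on `ι` -/

/-- **Singularity of a principal submatrix, read on the ambient index type**: `det M[Y] = 0` iff some
nonzero vector supported on `Y` is killed by `M` on `Y`. [folklore] -/
theorem det_submatrix_eq_zero_iff (M : Matrix ι ι 𝔽) (Y : Finset ι) :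
    (M.submatrix (Subtype.val : ↥Y → ι) Subtype.val).det = 0 ↔
      ∃ x : ι → 𝔽, x ≠ 0 ∧ (∀ i, i ∉ Y → x i = 0) ∧ ∀ i ∈ Y, (M *ᵥ x) i = 0 := by
  classical
  rw [← Matrix.exists_mulVec_eq_zero_iff]
  -- the row of `M[Y] v` at `k` is the row of `M x̃` at `k`, `x̃` the extension of `v` by zero
  have hrow : ∀ (v : ↥Y → 𝔽) (k : ↥Y),
      (M.submatrix (Subtype.val : ↥Y → ι) Subtype.val *ᵥ v) k =
        (M *ᵥ fun i => if h : i ∈ Y then v ⟨i, h⟩ else 0) (k : ι) := by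
    intro v k
    simp only [Matrix.mulVec, dotProduct, Matrix.submatrix_apply]
    rw [← Finset.sum_add_sum_compl Y, ← Finset.sum_coe_sort Y]
    have h0 : ∑ i ∈ Yᶜ, M k i * (fun i => if h : i ∈ Y then v ⟨i, h⟩ else 0) i = 0 :=
      Finset.sum_eq_zero fun i hi => by
        rw [Finset.mem_compl] at hi
        simp [hi]
    rw [h0, add_zero]
    refine Finset.sum_congr rfl fun j _ => ?_
    simp [j.2]
  constructor
  · rintro ⟨v, hv0, hv⟩
    refine ⟨fun i => if h : i ∈ Y then v ⟨i, h⟩ else 0, ?_, fun i hi => by simp [hi], fun i hi => ?_⟩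
    · intro h0
      apply hv0
      funext k
      have := congrFun h0 (k : ι)
      simpa [k.2] using this
    · have := congrFun hv ⟨i, hi⟩
      rw [hrow] at this
      simpa using this
  · rintro ⟨x, hx0, hxY, hx⟩
    refine ⟨fun k => x k, ?_, ?_⟩
    · intro h0
      apply hx0
      funext i
      by_cases hi : i ∈ Y
      · exact congrFun h0 ⟨i, hi⟩
      · exact hxY i hi
    · funext k
      rw [hrow]
      have e : (fun i => if h : i ∈ Y then (fun k : ↥Y => x k) ⟨i, h⟩ else 0) = x := by
        funext i
        by_cases hi : i ∈ Y
        · simp [hi]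
        · simp [hi, hxY i hi]
      rw [e]
      exact hx k k.2

/-! ## The principal pivot transform -/

/-- **The principal pivot transform of `M` at `A`** (Tucker), entrywise:
`[[M[A]⁻¹, -M[A]⁻¹ M[A,B]], [M[B,A] M[A]⁻¹, M[B] - M[B,A] M[A]⁻¹ M[A,B]]]`, `B = ι ∖ A`.  (Plumbing
definition: the object whose exchange relation is proved below; no Mathlib counterpart.)
[cite: Tsatsomeros2000, Def. (1.1)] -/
noncomputable def pivot (M : Matrix ι ι 𝔽) (A : Finset ι) : Matrix ι ι 𝔽 := fun i j =>
  if hi : i ∈ A then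
    if hj : j ∈ A then (M.submatrix (Subtype.val : ↥A → ι) Subtype.val)⁻¹ ⟨i, hi⟩ ⟨j, hj⟩
    else -∑ a : ↥A, (M.submatrix (Subtype.val : ↥A → ι) Subtype.val)⁻¹ ⟨i, hi⟩ a * M a j
  else
    if hj : j ∈ A then ∑ a : ↥A, M i a * (M.submatrix (Subtype.val : ↥A → ι) Subtype.val)⁻¹ a ⟨j, hj⟩
    else M i j - ∑ a : ↥A, ∑ b : ↥A,
      M i a * (M.submatrix (Subtype.val : ↥A → ι) Subtype.val)⁻¹ a b * M b j

section Exchange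

variable (M : Matrix ι ι 𝔽) (A : Finset ι)

/-- Splitting a sum over `ι` along `A`. [folklore] -/
theorem sum_eq_sum_coe_add_sum_compl (f : ι → 𝔽) :
    ∑ j, f j = ∑ a : ↥A, f a + ∑ j ∈ Aᶜ, f j := by
  rw [Finset.sum_coe_sort A f, Finset.sum_add_sum_compl]

variable {M A}

omit [Fintype ι] in
/-- `M[A]⁻¹ M[A] = 1`, entrywise. [folklore] -/
theorem sum_inv_mul_apply (hA : IsUnit (M.submatrix (Subtype.val : ↥A → ι) Subtype.val).det)
    (i b : ↥A) :
    ∑ a : ↥A, (M.submatrix (Subtype.val : ↥A → ι) Subtype.val)⁻¹ i a * M a b =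
      if i = b then 1 else 0 := by
  have h := Matrix.nonsing_inv_mul _ hA
  have := congrFun (congrFun h i) b
  rw [Matrix.mul_apply, Matrix.one_apply] at this
  simpa [Matrix.submatrix_apply] using this

omit [Fintype ι] in
/-- `M[A] M[A]⁻¹ = 1`, entrywise. [folklore] -/
theorem sum_mul_inv_apply (hA : IsUnit (M.submatrix (Subtype.val : ↥A → ι) Subtype.val).det)
    (a c : ↥A) :
    ∑ b : ↥A, M a b * (M.submatrix (Subtype.val : ↥A → ι) Subtype.val)⁻¹ b c =
      if a = c then 1 else 0 := by
  have h := Matrix.mul_nonsing_inv _ hA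
  have := congrFun (congrFun h a) c
  rw [Matrix.mul_apply, Matrix.one_apply] at this
  simpa [Matrix.submatrix_apply] using this

/-- **Exchange relation, forward** (Tucker): `pivot M A` sends `(Mx|_A, x|_B)` to `(x|_A, Mx|_B)`.
[cite: Tsatsomeros2000, Lemma 3.3] -/
theorem pivot_mulVec_piecewise (hA : IsUnit (M.submatrix (Subtype.val : ↥A → ι) Subtype.val).det)
    (x : ι → 𝔽) :
    pivot M A *ᵥ A.piecewise (M *ᵥ x) x = A.piecewise x (M *ᵥ x) := by
  classical
  set T := (M.submatrix (Subtype.val : ↥A → ι) (Subtype.val : ↥A → ι))⁻¹ with hT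
  -- `(M x) a` split along `A`
  have hMx : ∀ i : ι, (M *ᵥ x) i = ∑ b : ↥A, M i b * x b + ∑ k ∈ Aᶜ, M i k * x k := fun i => by
    simp only [Matrix.mulVec, dotProduct]
    exact sum_eq_sum_coe_add_sum_compl A _
  funext i
  simp only [Matrix.mulVec, dotProduct]
  rw [sum_eq_sum_coe_add_sum_compl A]
  have hzA : ∀ a : ↥A, A.piecewise (M *ᵥ x) x a = (M *ᵥ x) a := fun a =>
    Finset.piecewise_eq_of_mem _ _ _ a.2
  have hzB : ∀ j ∈ Aᶜ, A.piecewise (M *ᵥ x) x j = x j := fun j hj =>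
    Finset.piecewise_eq_of_notMem _ _ _ (Finset.mem_compl.mp hj)
  by_cases hi : i ∈ A
  · -- row `i ∈ A`: `∑_a T i a (Mx)_a - ∑_{j ∉ A} (∑_a T i a M a j) x_j = x_i`
    rw [Finset.piecewise_eq_of_mem _ _ _ hi]
    have h1 : ∑ a : ↥A, pivot M A i a * A.piecewise (M *ᵥ x) x a =
        ∑ a : ↥A, T ⟨i, hi⟩ a * (M *ᵥ x) a := by
      refine Finset.sum_congr rfl fun a _ => ?_
      rw [hzA a]
      simp [pivot, hi, a.2, hT]
    have h2 : ∑ j ∈ Aᶜ, pivot M A i j * A.piecewise (M *ᵥ x) x j =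
        ∑ j ∈ Aᶜ, (-∑ a : ↥A, T ⟨i, hi⟩ a * M a j) * x j := by
      refine Finset.sum_congr rfl fun j hj => ?_
      rw [hzB j hj]
      simp [pivot, hi, Finset.mem_compl.mp hj, hT]
    rw [h1, h2]
    simp_rw [hMx, mul_add, Finset.sum_add_distrib, Finset.mul_sum]
    -- `∑_a ∑_b T i a M a b x b = x i`
    have h3 : ∑ a : ↥A, ∑ b : ↥A, T ⟨i, hi⟩ a * (M a b * x b) = x i := by
      rw [Finset.sum_comm]
      simp_rw [← mul_assoc, ← Finset.sum_mul]
      simp_rw [hT, sum_inv_mul_apply hA]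
      simp
    rw [h3]
    have h4 : ∑ a : ↥A, ∑ k ∈ Aᶜ, T ⟨i, hi⟩ a * (M a k * x k) =
        ∑ k ∈ Aᶜ, (∑ a : ↥A, T ⟨i, hi⟩ a * M a k) * x k := by
      rw [Finset.sum_comm]
      refine Finset.sum_congr rfl fun k _ => ?_
      rw [Finset.sum_mul]
      refine Finset.sum_congr rfl fun a _ => ?_
      ring
    rw [h4, add_assoc, ← Finset.sum_add_distrib, add_eq_left]
    refine Finset.sum_eq_zero fun k _ => ?_
    ring
  · -- row `i ∉ A`
    rw [Finset.piecewise_eq_of_notMem _ _ _ hi]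
    have h1 : ∑ a : ↥A, pivot M A i a * A.piecewise (M *ᵥ x) x a =
        ∑ a : ↥A, (∑ b : ↥A, M i b * T b a) * (M *ᵥ x) a := by
      refine Finset.sum_congr rfl fun a _ => ?_
      rw [hzA a]
      simp [pivot, hi, a.2, hT]
    have h2 : ∑ j ∈ Aᶜ, pivot M A i j * A.piecewise (M *ᵥ x) x j =
        ∑ j ∈ Aᶜ, (M i j - ∑ a : ↥A, ∑ b : ↥A, M i a * T a b * M b j) * x j := by
      refine Finset.sum_congr rfl fun j hj => ?_
      rw [hzB j hj]
      simp [pivot, hi, Finset.mem_compl.mp hj, hT]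
    rw [h1, h2, hMx i]
    -- expand `(M x) a` inside `h1`
    have h3 : ∑ a : ↥A, (∑ b : ↥A, M i b * T b a) * (M *ᵥ x) a =
        ∑ c : ↥A, M i c * x c +
          ∑ k ∈ Aᶜ, (∑ a : ↥A, ∑ b : ↥A, M i b * T b a * M a k) * x k := by
      simp_rw [hMx, mul_add, Finset.sum_add_distrib]
      congr 1
      · -- `∑_a (∑_b M i b T b a) ∑_c M a c x c = ∑_c M i c x c`
        simp_rw [Finset.mul_sum, Finset.sum_mul]
        rw [Finset.sum_comm]
        refine Finset.sum_congr rfl fun c _ => ?_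
        rw [Finset.sum_comm]
        have : ∀ b : ↥A, ∑ a : ↥A, M i b * T b a * (M a c * x c) =
            M i b * ((∑ a : ↥A, T b a * M a c) * x c) := fun b => by
          rw [Finset.sum_mul, Finset.mul_sum]
          refine Finset.sum_congr rfl fun a _ => by ring
        simp_rw [this, hT, sum_inv_mul_apply hA]
        simp [Finset.sum_ite_eq', ite_mul, one_mul, zero_mul]
      · simp_rw [Finset.mul_sum, Finset.sum_mul]
        rw [Finset.sum_comm]
        refine Finset.sum_congr rfl fun k _ => ?_
        refine Finset.sum_congr rfl fun a _ => ?_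
        refine Finset.sum_congr rfl fun b _ => by ring
    rw [h3, add_assoc, ← Finset.sum_add_distrib]
    congr 1
    refine Finset.sum_congr rfl fun k _ => ?_
    have : ∑ a : ↥A, ∑ b : ↥A, M i b * T b a * M a k = ∑ a : ↥A, ∑ b : ↥A, M i a * T a b * M b k := by
      rw [Finset.sum_comm]
    rw [this]
    ring

/-- **Exchange relation, backward**: `M` sends `((pivot M A) z|_A, z|_B)` to `(z|_A, (pivot M A) z|_B)`.
[cite: Tsatsomeros2000, Lemma 3.3] -/
theorem mulVec_piecewise_pivot (hA : IsUnit (M.submatrix (Subtype.val : ↥A → ι) Subtype.val).det)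
    (z : ι → 𝔽) :
    M *ᵥ A.piecewise (pivot M A *ᵥ z) z = A.piecewise z (pivot M A *ᵥ z) := by
  classical
  set T := (M.submatrix (Subtype.val : ↥A → ι) (Subtype.val : ↥A → ι))⁻¹ with hT
  -- the two halves of `(pivot M A) z`
  have hPz : ∀ i : ι, (pivot M A *ᵥ z) i =
      ∑ a : ↥A, pivot M A i a * z a + ∑ k ∈ Aᶜ, pivot M A i k * z k := fun i => by
    simp only [Matrix.mulVec, dotProduct]
    exact sum_eq_sum_coe_add_sum_compl A _
  have hPzA : ∀ c : ↥A, (pivot M A *ᵥ z) c =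
      ∑ a : ↥A, T c a * z a - ∑ k ∈ Aᶜ, (∑ a : ↥A, T c a * M a k) * z k := fun c => by
    rw [hPz, sub_eq_add_neg, ← Finset.sum_neg_distrib]
    congr 1
    · refine Finset.sum_congr rfl fun a _ => ?_
      simp [pivot, c.2, a.2, hT]
    · refine Finset.sum_congr rfl fun k hk => ?_
      simp [pivot, c.2, Finset.mem_compl.mp hk, hT]
  funext i
  simp only [Matrix.mulVec, dotProduct]
  rw [sum_eq_sum_coe_add_sum_compl A]
  have hwA : ∀ a : ↥A, A.piecewise (pivot M A *ᵥ z) z a = (pivot M A *ᵥ z) a := fun a =>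
    Finset.piecewise_eq_of_mem _ _ _ a.2
  have hwB : ∀ j ∈ Aᶜ, A.piecewise (pivot M A *ᵥ z) z j = z j := fun j hj =>
    Finset.piecewise_eq_of_notMem _ _ _ (Finset.mem_compl.mp hj)
  have hfirst : ∑ a : ↥A, M i a * A.piecewise (pivot M A *ᵥ z) z a =
      ∑ a : ↥A, M i a * (∑ c : ↥A, T a c * z c) -
        ∑ k ∈ Aᶜ, (∑ a : ↥A, ∑ c : ↥A, M i a * T a c * M c k) * z k := by
    simp_rw [hwA, hPzA, mul_sub, Finset.sum_sub_distrib]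
    congr 1
    simp_rw [Finset.mul_sum, Finset.sum_mul]
    rw [Finset.sum_comm]
    refine Finset.sum_congr rfl fun k _ => ?_
    refine Finset.sum_congr rfl fun a _ => ?_
    rw [Finset.mul_sum]
    refine Finset.sum_congr rfl fun c _ => by ring
  have hsecond : ∑ j ∈ Aᶜ, M i j * A.piecewise (pivot M A *ᵥ z) z j = ∑ j ∈ Aᶜ, M i j * z j :=
    Finset.sum_congr rfl fun j hj => by rw [hwB j hj]
  rw [hfirst, hsecond]
  by_cases hi : i ∈ A
  · -- row `i ∈ A`: `∑_a M i a ∑_c T a c z c = z i` and the `Aᶜ`-sums cancel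
    rw [Finset.piecewise_eq_of_mem _ _ _ hi]
    have h3 : ∑ a : ↥A, M i a * ∑ c : ↥A, T a c * z c = z i := by
      simp_rw [Finset.mul_sum, ← mul_assoc]
      rw [Finset.sum_comm]
      simp_rw [← Finset.sum_mul]
      have : ∀ c : ↥A, ∑ a : ↥A, M i a * T a c = if (⟨i, hi⟩ : ↥A) = c then 1 else 0 := fun c =>
        sum_mul_inv_apply hA ⟨i, hi⟩ c
      simp_rw [hT] at this ⊢
      simp_rw [this]
      simp [ite_mul]
    have h4 : ∀ k : ι, ∑ a : ↥A, ∑ c : ↥A, M i a * T a c * M c k = M i k := fun k => by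
      rw [Finset.sum_comm]
      have : ∀ c : ↥A, ∑ a : ↥A, M i a * T a c * M c k = (∑ a : ↥A, M i a * T a c) * M c k :=
        fun c => by rw [Finset.sum_mul]
      simp_rw [this]
      have h' : ∀ c : ↥A, ∑ a : ↥A, M i a * T a c = if (⟨i, hi⟩ : ↥A) = c then 1 else 0 := fun c =>
        by rw [hT]; exact sum_mul_inv_apply hA ⟨i, hi⟩ c
      simp_rw [h']
      simp [ite_mul]
    simp_rw [h4]
    rw [h3, sub_add_cancel]
  · -- row `i ∉ A`: equals `(pivot z) i`
    rw [Finset.piecewise_eq_of_notMem _ _ _ hi, hPz i]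
    have h5 : ∑ a : ↥A, pivot M A i a * z a = ∑ a : ↥A, M i a * ∑ c : ↥A, T a c * z c := by
      have : ∀ c : ↥A, pivot M A i c = ∑ a : ↥A, M i a * T a c := fun c => by
        simp [pivot, hi, c.2, hT]
      simp_rw [this, Finset.sum_mul, Finset.mul_sum]
      rw [Finset.sum_comm]
      refine Finset.sum_congr rfl fun a _ => Finset.sum_congr rfl fun c _ => by ring
    have h6 : ∑ k ∈ Aᶜ, pivot M A i k * z k =
        ∑ k ∈ Aᶜ, M i k * z k - ∑ k ∈ Aᶜ, (∑ a : ↥A, ∑ c : ↥A, M i a * T a c * M c k) * z k := by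
      rw [← Finset.sum_sub_distrib]
      refine Finset.sum_congr rfl fun k hk => ?_
      have : pivot M A i k = M i k - ∑ a : ↥A, ∑ c : ↥A, M i a * T a c * M c k := by
        simp [pivot, hi, Finset.mem_compl.mp hk, hT]
      rw [this]
      ring
    rw [h5, h6]
    ring

/-! ## Tucker's theorem, determinant-free form: singular principal minors are exchanged by `· ∆ A` -/

/-- **`(pivot M A)[Y]` is singular iff `M[Y ∆ A]` is singular** (Tucker 1960; Tsatsomeros Thm. 3.1:
`det (pivot M A)[Y] = det M[Y ∆ A] / det M[A]`, here only its vanishing).  Kernel vectors are exchanged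
by `z ↦ ((pivot M A) z|_A, z|_B)` and `x ↦ (Mx|_A, x|_B)`. [cite: Tsatsomeros2000, Thm. 3.1] -/
theorem det_submatrix_pivot_eq_zero_iff
    (hA : IsUnit (M.submatrix (Subtype.val : ↥A → ι) Subtype.val).det) (Y : Finset ι) :
    ((pivot M A).submatrix (Subtype.val : ↥Y → ι) Subtype.val).det = 0 ↔
      (M.submatrix (Subtype.val : ↥(symmDiff Y A) → ι) Subtype.val).det = 0 := by
  classical
  rw [det_submatrix_eq_zero_iff, det_submatrix_eq_zero_iff]
  have hmemΔ : ∀ i, i ∈ symmDiff Y A ↔ (i ∈ Y ∧ i ∉ A) ∨ (i ∈ A ∧ i ∉ Y) := fun i => by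
    rw [Finset.mem_symmDiff]
  constructor
  · rintro ⟨z, hz0, hzY, hz⟩
    refine ⟨A.piecewise (pivot M A *ᵥ z) z, ?_, ?_, ?_⟩
    · intro h0
      apply hz0
      have key := mulVec_piecewise_pivot hA z
      rw [h0, Matrix.mulVec_zero] at key
      funext i
      by_cases hi : i ∈ A
      · simpa [Finset.piecewise_eq_of_mem _ _ _ hi] using (congrFun key i).symm
      · have := congrFun h0 i
        rw [Finset.piecewise_eq_of_notMem _ _ _ hi] at this
        simpa using this
    · intro i hi
      by_cases hiA : i ∈ A
      · rw [Finset.piecewise_eq_of_mem _ _ _ hiA]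
        have hiY : i ∈ Y := by
          by_contra h
          exact hi ((hmemΔ i).mpr (Or.inr ⟨hiA, h⟩))
        exact hz i hiY
      · rw [Finset.piecewise_eq_of_notMem _ _ _ hiA]
        exact hzY i fun hiY => hi ((hmemΔ i).mpr (Or.inl ⟨hiY, hiA⟩))
    · intro i hi
      rw [mulVec_piecewise_pivot hA z]
      rw [hmemΔ] at hi
      rcases hi with ⟨hiY, hiA⟩ | ⟨hiA, hiY⟩
      · rw [Finset.piecewise_eq_of_notMem _ _ _ hiA]; exact hz i hiY
      · rw [Finset.piecewise_eq_of_mem _ _ _ hiA]; exact hzY i hiY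
  · rintro ⟨x, hx0, hxΔ, hx⟩
    refine ⟨A.piecewise (M *ᵥ x) x, ?_, ?_, ?_⟩
    · intro h0
      apply hx0
      have key := pivot_mulVec_piecewise hA x
      rw [h0, Matrix.mulVec_zero] at key
      funext i
      by_cases hi : i ∈ A
      · simpa [Finset.piecewise_eq_of_mem _ _ _ hi] using (congrFun key i).symm
      · have := congrFun h0 i
        rw [Finset.piecewise_eq_of_notMem _ _ _ hi] at this
        simpa using this
    · intro i hi
      by_cases hiA : i ∈ A
      · rw [Finset.piecewise_eq_of_mem _ _ _ hiA]
        exact hx i ((hmemΔ i).mpr (Or.inr ⟨hiA, hi⟩))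
      · rw [Finset.piecewise_eq_of_notMem _ _ _ hiA]
        exact hxΔ i fun h => by
          rcases (hmemΔ i).mp h with ⟨hiY, -⟩ | ⟨hA', -⟩
          · exact hi hiY
          · exact hiA hA'
    · intro i hi
      rw [pivot_mulVec_piecewise hA x]
      by_cases hiA : i ∈ A
      · rw [Finset.piecewise_eq_of_mem _ _ _ hiA]
        exact hxΔ i fun h => by
          rcases (hmemΔ i).mp h with ⟨-, hA'⟩ | ⟨-, hiY⟩
          · exact hA' hiA
          · exact hiY hi
      · rw [Finset.piecewise_eq_of_notMem _ _ _ hiA]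
        exact hx i ((hmemΔ i).mpr (Or.inl ⟨hi, hiA⟩))

end Exchange

end Summit.BirchSwinnertonDyer.Rank1Residual.X5.SelmerSolitaire
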